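import Summits.Parity.GeneralizedHardyLittlewood.Theorems.BeyondDiagonalBeatsQuarter.KernelFormXSqBridge
import Literature.NumberTheory.Sieve.MoebiusShiftedPrimesMinorArcForm
import HarnessLib

/-!
# Route `PrimeLevelFamEdge`, crux K_B (stmt-Parity-20343), line `diagonal_kernel_split`, prover check C1
# (Mellin-bump lemma), part 2: Abel summation against a bounded-variation weight

The elementary engine of GATE G1 §4 (iv) («at least one of `m₁, m₂` exceeds `√Y`, and the Möbius sum over
that variable on a fixed multiplicative window with smooth weights saves every power of log»):
* `abs_sum_mul_le_of_tv` — Abel bound `|Σ_{u<e≤w} a(e)φ(e)| ≤ η·(Σ|φ(e) − φ(e+1)| + |φ(u+1)|)` when the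
  partial sums `A(e) = Σ_{j ≤ e} a(j)` are `≤ η` wherever the weight moves;
* `tv_mul_le` — variation of a product; `tv_antitone_le` — an antitone non-negative weight varies by at most
  its first value; `tv_comp_mul_le` — a `K`-Lipschitz bump supported in `[a, b] ⊂ (0,∞)` sampled along `c·ℕ`
  varies by at most `K(b − a) + 2Kc`, and `abs_le_of_lip` — it is bounded by `K·b`;
* `logWeight`, the `X²` log-profile `(log(M/e)/log M)²·𝟙[e ≤ ⌊M⌋]` as a weight on `ℕ`: values in `[0,1]`,
  antitone from `e = 1` on (`logWeight_succ_le`), and `xsq M m / m = W(m)·logWeight M m`;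
* `sum_inv_filter_le` — the harmonic bound (tree: `Lichtman2020.sum_Icc_inv_le_one_add_log`) restricted to `m ≤ X`.
Helper toward the heart stub (plan Ω, C1); closes nothing; standard axioms.
«The programme SEARCHES and TYPES; no claim about Landau–Siegel zeros, Theorems 1–2 of arXiv:2211.02515 or
a repaired Margin232 until a kernel theorem says so.»
-/

noncomputable section

open scoped Real ArithmeticFunction.Moebius
open Finset ArithmeticFunction

namespace Summit.Parity.GeneralizedHardyLittlewood.Theorems.BeyondDiagonalBeatsQuarter.MellinBump

open Literature.NumberTheory.LFunctions Literature.NumberTheory.LFunctions.KMV2000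
open MollifierMainTerm (W)
open KernelFormXSq

/-! ### Abel summation against a weight of bounded variation -/

/-- **Abel bound with a bounded-variation weight.** If `φ(w+1) = 0` and `|A(e)| ≤ η` for every
`u ≤ e ≤ w` at which the weight moves (`φ(e) ≠ 0` or `φ(e+1) ≠ 0`), `A(e) = Σ_{j ≤ e} a(j)`, then
`|Σ_{u<e≤w} a(e)φ(e)| ≤ η·(Σ_{u<e≤w} |φ(e) − φ(e+1)| + |φ(u+1)|)`. [folklore] -/
theorem abs_sum_mul_le_of_tv (a φ : ℕ → ℝ) {u w : ℕ} (huw : u ≤ w) {η : ℝ}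
    (hA : ∀ e, u ≤ e → e ≤ w → (φ e ≠ 0 ∨ φ (e + 1) ≠ 0) → |∑ j ∈ Icc 1 e, a j| ≤ η)
    (hw : φ (w + 1) = 0) :
    |∑ e ∈ Ioc u w, a e * φ e| ≤ η * (∑ e ∈ Ioc u w, |φ e - φ (e + 1)| + |φ (u + 1)|) := by
  rw [sum_Ioc_mul_eq_abel a φ huw, hw, mul_zero, add_zero]
  have h1 : ∀ e ∈ Ioc u w, |(∑ j ∈ Icc 1 e, a j) * (φ e - φ (e + 1))| ≤ η * |φ e - φ (e + 1)| := by
    intro e he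
    rw [Finset.mem_Ioc] at he
    rw [abs_mul]
    by_cases hz : φ e - φ (e + 1) = 0
    · rw [hz, abs_zero, mul_zero, mul_zero]
    · have hmv : φ e ≠ 0 ∨ φ (e + 1) ≠ 0 := by
        by_contra hcon
        push Not at hcon
        exact hz (by rw [hcon.1, hcon.2, sub_zero])
      exact mul_le_mul_of_nonneg_right (hA e he.1.le he.2 hmv) (abs_nonneg _)
  have h2 : |(∑ j ∈ Icc 1 u, a j) * φ (u + 1)| ≤ η * |φ (u + 1)| := by
    rw [abs_mul]
    by_cases hz : φ (u + 1) = 0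
    · rw [hz, abs_zero, mul_zero, mul_zero]
    · exact mul_le_mul_of_nonneg_right (hA u le_rfl huw (Or.inr hz)) (abs_nonneg _)
  calc |∑ e ∈ Ioc u w, (∑ j ∈ Icc 1 e, a j) * (φ e - φ (e + 1)) - (∑ j ∈ Icc 1 u, a j) * φ (u + 1)|
      ≤ |∑ e ∈ Ioc u w, (∑ j ∈ Icc 1 e, a j) * (φ e - φ (e + 1))| +
          |(∑ j ∈ Icc 1 u, a j) * φ (u + 1)| := abs_sub _ _
    _ ≤ ∑ e ∈ Ioc u w, η * |φ e - φ (e + 1)| + η * |φ (u + 1)| := by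
        gcongr
        exact (Finset.abs_sum_le_sum_abs _ _).trans (Finset.sum_le_sum h1)
    _ = η * (∑ e ∈ Ioc u w, |φ e - φ (e + 1)| + |φ (u + 1)|) := by rw [← Finset.mul_sum]; ring

/-! ### Total-variation bookkeeping -/

/-- Variation of a product: `Σ|xg(e) − xg(e+1)| ≤ B·Σ|x(e) − x(e+1)| + Σ|g(e) − g(e+1)|` when `|x| ≤ 1`,
`|g| ≤ B`. [folklore] -/
theorem tv_mul_le (x g : ℕ → ℝ) (s : Finset ℕ) {B : ℝ} (hx : ∀ n, |x n| ≤ 1) (hg : ∀ n, |g n| ≤ B) :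
    ∑ e ∈ s, |x e * g e - x (e + 1) * g (e + 1)| ≤
      B * ∑ e ∈ s, |x e - x (e + 1)| + ∑ e ∈ s, |g e - g (e + 1)| := by
  rw [Finset.mul_sum, ← Finset.sum_add_distrib]
  refine Finset.sum_le_sum fun e _ ↦ ?_
  have hB : 0 ≤ B := (abs_nonneg _).trans (hg 0)
  have e1 : x e * g e - x (e + 1) * g (e + 1) =
      (x e - x (e + 1)) * g e + x (e + 1) * (g e - g (e + 1)) := by ring
  rw [e1]
  calc |(x e - x (e + 1)) * g e + x (e + 1) * (g e - g (e + 1))|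
      ≤ |(x e - x (e + 1)) * g e| + |x (e + 1) * (g e - g (e + 1))| := abs_add_le _ _
    _ = |x e - x (e + 1)| * |g e| + |x (e + 1)| * |g e - g (e + 1)| := by rw [abs_mul, abs_mul]
    _ ≤ |x e - x (e + 1)| * B + 1 * |g e - g (e + 1)| := by
        gcongr
        · exact hg e
        · exact hx (e + 1)
    _ = B * |x e - x (e + 1)| + |g e - g (e + 1)| := by ring

/-- An antitone (from `u+1` on) non-negative weight varies on `(u, w]` by at most its value at `u+1`.
[folklore] -/
theorem tv_antitone_le (x : ℕ → ℝ) {u w : ℕ} (huw : u ≤ w) (h0 : ∀ n, 0 ≤ x n)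
    (hanti : ∀ e, u < e → x (e + 1) ≤ x e) :
    ∑ e ∈ Ioc u w, |x e - x (e + 1)| ≤ x (u + 1) := by
  have h1 : ∑ e ∈ Ioc u w, |x e - x (e + 1)| = ∑ e ∈ Ioc u w, (x e - x (e + 1)) :=
    Finset.sum_congr rfl fun e he ↦ abs_of_nonneg (by
      have := hanti e (Finset.mem_Ioc.1 he).1; linarith)
  rw [h1, sum_Ioc_sub_succ x huw]
  linarith [h0 (w + 1)]

/-- A `K`-Lipschitz function supported in `[a, b]`, `0 < a`, is bounded by `K·b`. [folklore] -/
theorem abs_le_of_lip {h : ℝ → ℝ} {a b K : ℝ} (ha : 0 < a) (hab : a ≤ b) (hK : 0 ≤ K)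
    (hLip : ∀ x y, |h x - h y| ≤ K * |x - y|) (hsupp : ∀ y, h y ≠ 0 → a ≤ y ∧ y ≤ b) (y : ℝ) :
    |h y| ≤ K * b := by
  have h0 : h 0 = 0 := by
    by_contra hne; have := (hsupp 0 hne).1; linarith
  by_cases hy : h y = 0
  · rw [hy, abs_zero]; exact mul_nonneg hK (by linarith)
  · obtain ⟨hay, hyb⟩ := hsupp y hy
    have := hLip y 0
    rw [h0, sub_zero, sub_zero] at this
    rw [abs_of_pos (show (0 : ℝ) < y by linarith)] at this
    calc |h y| ≤ K * y := this
      _ ≤ K * b := mul_le_mul_of_nonneg_left hyb hK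

/-- **Variation of a Lipschitz bump along an arithmetic progression.** For `h` `K`-Lipschitz, supported in
`[a, b]` with `0 < a ≤ b`, and `c > 0`: `Σ_{e ∈ s} |h(ce) − h(c(e+1))| ≤ K(b − a) + 2Kc` (only the
`≤ (b − a)/c + 2` integers `e ∈ [a/c − 1, b/c]` contribute, each at most `Kc`). [folklore] -/
theorem tv_comp_mul_le {h : ℝ → ℝ} {a b K c : ℝ} (ha : 0 < a) (hab : a ≤ b) (hK : 0 ≤ K) (hc : 0 < c)
    (hLip : ∀ x y, |h x - h y| ≤ K * |x - y|) (hsupp : ∀ y, h y ≠ 0 → a ≤ y ∧ y ≤ b)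
    (s : Finset ℕ) :
    ∑ e ∈ s, |h (c * e) - h (c * (e + 1))| ≤ K * (b - a) + 2 * K * c := by
  classical
  set T := s.filter (fun e : ℕ ↦ h (c * e) ≠ 0 ∨ h (c * (e + 1)) ≠ 0) with hT
  -- the sum lives on T
  have hsumT : ∑ e ∈ s, |h (c * e) - h (c * (e + 1))| = ∑ e ∈ T, |h (c * e) - h (c * (e + 1))| := by
    rw [hT, Finset.sum_filter]
    refine Finset.sum_congr rfl fun e _ ↦ ?_
    split_ifs with hne
    · rfl
    · push Not at hne; rw [hne.1, hne.2, sub_zero, abs_zero]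
  rw [hsumT]
  -- each term ≤ K c
  have hterm : ∀ e ∈ T, |h (c * e) - h (c * (e + 1))| ≤ K * c := by
    intro e _
    refine (hLip _ _).trans (le_of_eq ?_)
    rw [show c * (e : ℝ) - c * ((e : ℝ) + 1) = -c by ring, abs_neg, abs_of_pos hc]
  -- T ⊆ [⌈a/c - 1⌉, ⌊b/c⌋]
  set L : ℕ := ⌈a / c - 1⌉₊ with hL
  set U : ℕ := ⌊b / c⌋₊ with hU
  have hTsub : T ⊆ Finset.Icc L U := by
    intro e he
    rw [hT, Finset.mem_filter] at he
    rw [Finset.mem_Icc]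
    have hec : 0 ≤ c * e := by positivity
    have key : a / c - 1 ≤ (e : ℝ) ∧ (e : ℝ) ≤ b / c := by
      rcases he.2 with h1 | h1
      · obtain ⟨h2, h3⟩ := hsupp _ h1
        have h4 : a / c ≤ (e : ℝ) := by rw [div_le_iff₀ hc]; linarith
        have h5 : (e : ℝ) ≤ b / c := by rw [le_div_iff₀ hc]; linarith
        exact ⟨by linarith, h5⟩
      · obtain ⟨h2, h3⟩ := hsupp _ h1
        have h4 : a / c ≤ (e : ℝ) + 1 := by rw [div_le_iff₀ hc]; linarith
        have h5 : (e : ℝ) ≤ b / c := by rw [le_div_iff₀ hc]; nlinarith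
        exact ⟨by linarith, h5⟩
    exact ⟨Nat.ceil_le.2 key.1, Nat.le_floor key.2⟩
  rcases T.eq_empty_or_nonempty with hTe | hTne
  · rw [hTe, Finset.sum_empty]; nlinarith
  -- T nonempty ⇒ L ≤ U and card T ≤ U + 1 - L ≤ (b - a)/c + 2
  obtain ⟨e₀, he₀⟩ := hTne
  have hLU : L ≤ U := by have := Finset.mem_Icc.1 (hTsub he₀); omega
  have hcard : (T.card : ℝ) ≤ (b - a) / c + 2 := by
    have h1 : T.card ≤ U + 1 - L := by
      have := Finset.card_le_card hTsub; rwa [Nat.card_Icc] at this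
    have h2 : (T.card : ℝ) ≤ ((U + 1 - L : ℕ) : ℝ) := by exact_mod_cast h1
    rw [Nat.cast_sub (by omega), Nat.cast_add, Nat.cast_one] at h2
    have hLr : a / c - 1 ≤ (L : ℝ) := Nat.le_ceil _
    have hUr : (U : ℝ) ≤ b / c := Nat.floor_le (div_nonneg (by linarith) hc.le)
    have : (U : ℝ) + 1 - L ≤ (b - a) / c + 2 := by rw [sub_div]; linarith
    linarith
  calc ∑ e ∈ T, |h (c * e) - h (c * (e + 1))| ≤ T.card • (K * c) := Finset.sum_le_card_nsmul _ _ _ hterm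
    _ = (T.card : ℝ) * (K * c) := by rw [nsmul_eq_mul]
    _ ≤ ((b - a) / c + 2) * (K * c) := mul_le_mul_of_nonneg_right hcard (by positivity)
    _ = K * (b - a) + 2 * K * c := by field_simp

/-! ### The `X²` log-profile as a weight on `ℕ` -/

/-- The `X²` log-profile weight `λ_M(e) = (log(M/e)/log M)²·𝟙[e ≤ ⌊M⌋]` (a proof-local abbreviation of the
factor `x_m·m⁻¹/W(m)`; no new object). [cite: KowalskiMichelVanderKam2000, (9) p. 7 — derivation] -/
def logWeight (M : ℝ) (e : ℕ) : ℝ := if e ≤ ⌊M⌋₊ then (Real.log (M / e) / Real.log M) ^ 2 else 0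

/-- `λ_M(e) = 0` beyond `⌊M⌋`. [folklore] -/
theorem logWeight_of_lt {M : ℝ} {e : ℕ} (he : ⌊M⌋₊ < e) : logWeight M e = 0 := by
  rw [logWeight, if_neg (not_le.2 he)]

/-- `0 ≤ λ_M(e)`. [folklore] -/
theorem logWeight_nonneg (M : ℝ) (e : ℕ) : 0 ≤ logWeight M e := by
  unfold logWeight; split_ifs <;> positivity

/-- `λ_M(e) ≤ 1` for `e ≥ 1`, `M > 1`. [folklore] -/
theorem logWeight_le_one {M : ℝ} (hM : 1 < M) {e : ℕ} (he : 1 ≤ e) : logWeight M e ≤ 1 := by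
  unfold logWeight
  split_ifs with h
  · have hM0 : 0 < M := by linarith
    have hlogM : 0 < Real.log M := Real.log_pos hM
    have he0 : (0 : ℝ) < e := by exact_mod_cast he
    have heM : (e : ℝ) ≤ M := (Nat.cast_le.2 h).trans (Nat.floor_le hM0.le)
    have h1 : 0 ≤ Real.log (M / e) := Real.log_nonneg (by rw [le_div_iff₀ he0]; linarith)
    have h2 : Real.log (M / e) ≤ Real.log M := by
      rw [Real.log_div hM0.ne' he0.ne']
      linarith [Real.log_nonneg (by exact_mod_cast he : (1 : ℝ) ≤ e)]
    have h3 : Real.log (M / e) / Real.log M ≤ 1 := by rw [div_le_one hlogM]; exact h2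
    have h4 : 0 ≤ Real.log (M / e) / Real.log M := by positivity
    nlinarith
  · exact zero_le_one

/-- `|λ_M(e)| ≤ 1` for all `e` when `M > 1` (at `e = 0`, `log(M/0) = 0`). [folklore] -/
theorem abs_logWeight_le_one {M : ℝ} (hM : 1 < M) (e : ℕ) : |logWeight M e| ≤ 1 := by
  rw [abs_of_nonneg (logWeight_nonneg M e)]
  rcases Nat.eq_zero_or_pos e with rfl | he
  · unfold logWeight; split_ifs <;> simp
  · exact logWeight_le_one hM he

/-- `λ_M` is antitone from `e = 1` on (`M > 1`): `λ_M(e+1) ≤ λ_M(e)` for `e ≥ 1`. [folklore] -/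
theorem logWeight_succ_le {M : ℝ} (hM : 1 < M) {e : ℕ} (he : 1 ≤ e) :
    logWeight M (e + 1) ≤ logWeight M e := by
  by_cases h1 : e + 1 ≤ ⌊M⌋₊
  · have h0 : e ≤ ⌊M⌋₊ := by omega
    rw [logWeight, if_pos h1, logWeight, if_pos h0]
    have hM0 : 0 < M := by linarith
    have hlogM : 0 < Real.log M := Real.log_pos hM
    have he0 : (0 : ℝ) < e := by exact_mod_cast he
    have heM : ((e + 1 : ℕ) : ℝ) ≤ M := (Nat.cast_le.2 h1).trans (Nat.floor_le hM0.le)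
    push_cast at heM
    have ha : 0 ≤ Real.log (M / (e + 1)) := Real.log_nonneg (by rw [le_div_iff₀ (by linarith)]; linarith)
    have hb : Real.log (M / (e + 1)) ≤ Real.log (M / e) :=
      Real.log_le_log (by positivity) (div_le_div_of_nonneg_left hM0.le he0 (by linarith))
    push_cast
    have : Real.log (M / (e + 1)) / Real.log M ≤ Real.log (M / e) / Real.log M :=
      div_le_div_of_nonneg_right hb hlogM.le
    have h4 : 0 ≤ Real.log (M / (e + 1)) / Real.log M := by positivity
    nlinarith
  · rw [logWeight_of_lt (by omega)]
    exact logWeight_nonneg M e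

/-- `x_m/m = W(m)·λ_M(m)` on `1 ≤ m ≤ ⌊M⌋`. [cite: KowalskiMichelVanderKam2000, (9) p. 7 — derivation] -/
theorem xsq_div_eq {M : ℝ} {m : ℕ} (hm : 1 ≤ m) (hmM : m ≤ ⌊M⌋₊) :
    xsq M m / m = W m * logWeight M m := by
  rw [logWeight, if_pos hmM, xsq, W_apply'' (by omega)]
  have : (m : ℝ) ≠ 0 := by exact_mod_cast (by omega : m ≠ 0)
  field_simp

/-- `|x_m/m| ≤ 1/m` for `1 ≤ m ≤ ⌊M⌋`, `M > 1`. [folklore] -/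
theorem abs_xsq_div_le {M : ℝ} (hM : 1 < M) {m : ℕ} (hm : 1 ≤ m) (hmM : m ≤ ⌊M⌋₊) :
    |xsq M m / m| ≤ (m : ℝ)⁻¹ := by
  rw [xsq_div_eq hm hmM, abs_mul]
  calc |W m| * |logWeight M m| ≤ (m : ℝ)⁻¹ * 1 :=
        mul_le_mul (abs_W_le m) (abs_logWeight_le_one hM m) (abs_nonneg _) (by positivity)
    _ = (m : ℝ)⁻¹ := mul_one _

/-! ### Harmonic bound -/

/-- `Σ_{m ≤ N, m ≤ X} 1/m ≤ 1 + |log X|` for `X > 0`. [folklore] -/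
theorem sum_inv_filter_le {X : ℝ} (hX : 0 < X) (N : ℕ) :
    ∑ m ∈ (Icc 1 N).filter (fun m : ℕ ↦ (m : ℝ) ≤ X), (m : ℝ)⁻¹ ≤ 1 + |Real.log X| := by
  have hsub : (Icc 1 N).filter (fun m : ℕ ↦ (m : ℝ) ≤ X) ⊆ Icc 1 ⌊X⌋₊ := by
    intro m hm
    rw [Finset.mem_filter, Finset.mem_Icc] at hm
    rw [Finset.mem_Icc]
    exact ⟨hm.1.1, Nat.le_floor hm.2⟩
  refine (Finset.sum_le_sum_of_subset_of_nonneg hsub fun _ _ _ ↦ by positivity).trans ?_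
  refine (Literature.NumberTheory.Sieve.Lichtman2020.sum_Icc_inv_le_one_add_log _).trans ?_
  rcases lt_or_ge X 1 with h1 | h1
  · have : ⌊X⌋₊ = 0 := Nat.floor_eq_zero.2 h1
    rw [this]; simp
  · have hfl : (1 : ℝ) ≤ ⌊X⌋₊ := by exact_mod_cast Nat.one_le_floor_iff _ |>.2 h1
    have h2 : Real.log (⌊X⌋₊ : ℝ) ≤ Real.log X := Real.log_le_log (by linarith) (Nat.floor_le hX.le)
    linarith [le_abs_self (Real.log X)]

end Summit.Parity.GeneralizedHardyLittlewood.Theorems.BeyondDiagonalBeatsQuarter.MellinBump
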